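import Mathlib

/-!
# JointEigenbasis — an orthonormal basis of joint eigenvectors for a commuting family of
symmetric (or formally normal) operators on a finite-dimensional inner product space

Blind cell `pub-hodge-repro2`, seat p2 (Tier 5 kernel support for the Hecke side of N1 / N3 / N5:
the simultaneous diagonalisation of the Hecke operators on a finite-dimensional Hecke-stable
space of weight-`k` forms, once they are known to be adjoint to each other for the Petersson
product — `⟨T_δ f, g⟩ = ⟨f, T_{δ⁻¹} g⟩`, `HeckeSlashSelfAdjoint.lean` — and to commute).

Mathlib (`Mathlib/Analysis/InnerProductSpace/JointEigenspace.lean`) proves that the joint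
eigenspaces of a commuting family of symmetric operators on a finite-dimensional inner product
space form an orthogonal internal direct sum, but does not package a joint orthonormal
EIGENBASIS (its header lists this as a TODO). This file does so, indexed by `Fin (finrank 𝕜 E)`:

* `exists_orthonormalBasis_of_isSymmetric_of_commute` — a commuting family of symmetric operators
  has an orthonormal basis of joint eigenvectors;
* `exists_orthonormalBasis_of_isFormalAdjointPair_of_commute` — the same (over `ℂ`) for a commuting
  family closed under formal adjoints (`⟪T i x, y⟫ = ⟪x, T (σ i) y⟫`), through the symmetric parts
  `T i + T (σ i)` and `I • (T i - T (σ i))`;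
* `exists_orthonormalBasis_of_isFormalAdjointPair_of_commute_restrict` — the same on a
  finite-dimensional invariant subspace `V` of an arbitrary inner product space.
-/

namespace Summit.Ventures.HodgeRepro2.JointEigenbasis

open Module LinearMap

section RCLike

variable {𝕜 E n : Type*} [RCLike 𝕜] [NormedAddCommGroup E] [InnerProductSpace 𝕜 E]

/-- The joint eigenspace of the family `T` at the character `χ`. -/
abbrev commonEigenspace (T : n → E →ₗ[𝕜] E) (χ : n → 𝕜) : Submodule 𝕜 E :=
  ⨅ j, Module.End.eigenspace (T j) (χ j)

/-- Membership in the joint eigenspace: a joint eigenvector with eigenvalues `χ j`. -/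
theorem mem_commonEigenspace_iff {T : n → E →ₗ[𝕜] E} {χ : n → 𝕜} {v : E} :
    v ∈ commonEigenspace T χ ↔ ∀ j, T j v = χ j • v := by
  simp only [commonEigenspace, Submodule.mem_iInf, Module.End.mem_eigenspace_iff]

/-- A formal adjoint pair: `⟪T x, y⟫ = ⟪x, T' y⟫` for all `x y`. -/
def IsFormalAdjointPair (T T' : E →ₗ[𝕜] E) : Prop := ∀ x y, inner 𝕜 (T x) y = inner 𝕜 x (T' y)

/-- A formal adjoint pair is symmetric: `(T', T)` is one as well. -/
theorem IsFormalAdjointPair.symm {T T' : E →ₗ[𝕜] E} (h : IsFormalAdjointPair T T') :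
    IsFormalAdjointPair T' T := fun x y => by
  rw [← inner_conj_symm, ← h y x, inner_conj_symm]

/-- `T + T'` is symmetric for a formal adjoint pair `(T, T')`. -/
theorem IsFormalAdjointPair.isSymmetric_add {T T' : E →ₗ[𝕜] E} (h : IsFormalAdjointPair T T') :
    (T + T').IsSymmetric := fun x y => by
  simp only [LinearMap.add_apply, inner_add_left, inner_add_right, h x y, h.symm x y]
  ring

/-- `I • (T - T')` is symmetric for a formal adjoint pair `(T, T')`. -/
theorem IsFormalAdjointPair.isSymmetric_I_smul_sub {T T' : E →ₗ[𝕜] E}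
    (h : IsFormalAdjointPair T T') : ((RCLike.I : 𝕜) • (T - T')).IsSymmetric := fun x y => by
  simp only [LinearMap.smul_apply, LinearMap.sub_apply, inner_smul_left, inner_smul_right,
    inner_sub_left, inner_sub_right, h x y, h.symm x y, RCLike.conj_I]
  ring

section FiniteDimensional

variable [FiniteDimensional 𝕜 E]

/-- **Joint orthonormal eigenbasis for a commuting family of symmetric operators** on a
finite-dimensional inner product space. -/
theorem exists_orthonormalBasis_of_isSymmetric_of_commute (T : n → E →ₗ[𝕜] E)
    (hT : ∀ i, (T i).IsSymmetric) (hC : Pairwise (Function.onFun Commute T)) :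
    ∃ b : OrthonormalBasis (Fin (finrank 𝕜 E)) 𝕜 E, ∀ a i, ∃ μ : 𝕜, T i (b a) = μ • b a := by
  classical
  have hInt : DirectSum.IsInternal (fun χ : n → 𝕜 => commonEigenspace T χ) :=
    LinearMap.IsSymmetric.directSum_isInternal_of_pairwise_commute hT hC
  have hOrth : OrthogonalFamily 𝕜 (fun χ : n → 𝕜 => commonEigenspace T χ)
      (fun χ => (commonEigenspace T χ).subtypeₗᵢ) :=
    LinearMap.IsSymmetric.orthogonalFamily_iInf_eigenspaces hT
  have hInd : iSupIndep (fun χ : n → 𝕜 => commonEigenspace T χ) :=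
    ((DirectSum.isInternal_submodule_iff_iSupIndep_and_iSup_eq_top _).mp hInt).1
  letI : Fintype {χ : n → 𝕜 // commonEigenspace T χ ≠ ⊥} := hInd.fintypeNeBotOfFiniteDimensional
  have hInt' : DirectSum.IsInternal
      (fun χ : {χ : n → 𝕜 // commonEigenspace T χ ≠ ⊥} => commonEigenspace T χ) :=
    DirectSum.isInternal_ne_bot_iff.mpr hInt
  have hOrth' : OrthogonalFamily 𝕜
      (fun χ : {χ : n → 𝕜 // commonEigenspace T χ ≠ ⊥} => commonEigenspace T χ)
      (fun χ => (commonEigenspace T χ.1).subtypeₗᵢ) :=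
    hOrth.comp Subtype.val_injective
  let b₀ := hInt'.collectedOrthonormalBasis hOrth'
    (fun χ => stdOrthonormalBasis 𝕜 (commonEigenspace T χ.1))
  have hmem : ∀ a, b₀ a ∈ commonEigenspace T a.1.1 := fun a =>
    hInt'.collectedOrthonormalBasis_mem hOrth' _ a
  have hcard : finrank 𝕜 E = Fintype.card
      (Σ χ : {χ : n → 𝕜 // commonEigenspace T χ ≠ ⊥}, Fin (finrank 𝕜 (commonEigenspace T χ.1))) :=
    Module.finrank_eq_card_basis b₀.toBasis
  let e := (Fintype.equivFin _).trans (finCongr hcard.symm)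
  refine ⟨b₀.reindex e, fun a i => ⟨(e.symm a).1.1 i, ?_⟩⟩
  rw [OrthonormalBasis.reindex_apply]
  exact (mem_commonEigenspace_iff.mp (hmem (e.symm a))) i

end FiniteDimensional

end RCLike

section Complex

variable {E : Type*} [NormedAddCommGroup E] [InnerProductSpace ℂ E]

/-- Over `ℂ`, `T` is recovered from its two symmetric parts:
`T = (1/2) • ((T + T') - I • (I • (T - T')))`. -/
theorem eq_half_smul_add_sub_I_smul (T T' : E →ₗ[ℂ] E) :
    T = (1 / 2 : ℂ) • ((T + T') - Complex.I • (Complex.I • (T - T'))) := by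
  ext x
  simp only [LinearMap.smul_apply, LinearMap.sub_apply, LinearMap.add_apply, smul_smul,
    Complex.I_mul_I, neg_one_smul, sub_neg_eq_add]
  have h : T x + T' x + (T x - T' x) = (2 : ℂ) • T x := by rw [two_smul]; abel
  rw [h, smul_smul]
  norm_num

/-- Commutation of the symmetric parts of a commuting family closed under formal adjoints. -/
theorem commute_parts {ι : Type*} (T : ι → E →ₗ[ℂ] E) (σ : ι → ι)
    (hC : ∀ i j, Commute (T i) (T j)) (i j : ι) (b c : Bool) :
    Commute (if b then Complex.I • (T i - T (σ i)) else T i + T (σ i))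
      (if c then Complex.I • (T j - T (σ j)) else T j + T (σ j)) := by
  have h1 := hC i j
  have h2 := hC i (σ j)
  have h3 := hC (σ i) j
  have h4 := hC (σ i) (σ j)
  cases b <;> cases c <;> simp only [Bool.false_eq_true, ↓reduceIte]
  · exact (h1.add_right h2).add_left (h3.add_right h4)
  · exact ((h1.sub_right h2).add_left (h3.sub_right h4)).smul_right _
  · exact ((h1.add_right h2).sub_left (h3.add_right h4)).smul_left _
  · exact (((h1.sub_right h2).sub_left (h3.sub_right h4)).smul_left _).smul_right _

variable [FiniteDimensional ℂ E]

/-- **Joint orthonormal eigenbasis for a commuting family closed under formal adjoints**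
(`⟪T i x, y⟫ = ⟪x, T (σ i) y⟫`) on a finite-dimensional complex inner product space: the
symmetric parts `T i + T (σ i)`, `I • (T i - T (σ i))` commute pairwise, and a joint eigenvector
of the parts is a joint eigenvector of the `T i`. -/
theorem exists_orthonormalBasis_of_isFormalAdjointPair_of_commute {ι : Type*}
    (T : ι → E →ₗ[ℂ] E) (σ : ι → ι) (hadj : ∀ i, IsFormalAdjointPair (T i) (T (σ i)))
    (hC : ∀ i j, Commute (T i) (T j)) :
    ∃ b : OrthonormalBasis (Fin (finrank ℂ E)) ℂ E, ∀ a i, ∃ μ : ℂ, T i (b a) = μ • b a := by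
  let U : ι × Bool → E →ₗ[ℂ] E := fun p =>
    if p.2 then Complex.I • (T p.1 - T (σ p.1)) else T p.1 + T (σ p.1)
  have hU : ∀ p, (U p).IsSymmetric := by
    rintro ⟨i, b⟩
    cases b
    · exact (hadj i).isSymmetric_add
    · exact (hadj i).isSymmetric_I_smul_sub
  have hUC : Pairwise (Function.onFun Commute U) := by
    rintro ⟨i, b⟩ ⟨j, c⟩ -
    exact commute_parts T σ hC i j b c
  obtain ⟨b, hb⟩ := exists_orthonormalBasis_of_isSymmetric_of_commute U hU hUC
  refine ⟨b, fun a i => ?_⟩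
  obtain ⟨μ₁, hμ₁⟩ := hb a (i, false)
  obtain ⟨μ₂, hμ₂⟩ := hb a (i, true)
  simp only [U, Bool.false_eq_true, ↓reduceIte] at hμ₁ hμ₂
  refine ⟨(1 / 2 : ℂ) * (μ₁ - Complex.I * μ₂), ?_⟩
  conv_lhs => rw [eq_half_smul_add_sub_I_smul (T i) (T (σ i))]
  rw [LinearMap.smul_apply, LinearMap.sub_apply, LinearMap.smul_apply, hμ₁, hμ₂, smul_smul,
    ← sub_smul, smul_smul]

end Complex

section Restrict

variable {E : Type*} [NormedAddCommGroup E] [InnerProductSpace ℂ E]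

/-- **Joint orthonormal eigenbasis on a finite-dimensional invariant subspace.** For a family `T`
of operators on an (arbitrary) complex inner product space, closed under formal adjoints and
commuting, and a finite-dimensional subspace `V` stable under every `T i`, `V` has an orthonormal
basis of joint eigenvectors of the `T i`. -/
theorem exists_orthonormalBasis_of_isFormalAdjointPair_of_commute_restrict {ι : Type*}
    (T : ι → E →ₗ[ℂ] E) (σ : ι → ι) (hadj : ∀ i, IsFormalAdjointPair (T i) (T (σ i)))
    (hC : ∀ i j, Commute (T i) (T j)) (V : Submodule ℂ E) [FiniteDimensional ℂ V]
    (hV : ∀ i, ∀ v ∈ V, T i v ∈ V) :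
    ∃ b : OrthonormalBasis (Fin (finrank ℂ V)) ℂ V,
      ∀ a i, ∃ μ : ℂ, T i (b a : E) = μ • (b a : E) := by
  let R : ι → V →ₗ[ℂ] V := fun i => (T i).restrict (hV i)
  have hadjR : ∀ i, IsFormalAdjointPair (R i) (R (σ i)) := fun i x y => by
    simp only [R, Submodule.coe_inner, LinearMap.restrict_apply]
    exact hadj i x y
  have hCR : ∀ i j, Commute (R i) (R j) := fun i j => by
    refine LinearMap.ext fun x => Subtype.ext ?_
    simp only [R, Module.End.mul_apply, LinearMap.restrict_apply]
    exact LinearMap.congr_fun (hC i j).eq x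
  obtain ⟨b, hb⟩ := exists_orthonormalBasis_of_isFormalAdjointPair_of_commute R σ hadjR hCR
  refine ⟨b, fun a i => ?_⟩
  obtain ⟨μ, hμ⟩ := hb a i
  refine ⟨μ, ?_⟩
  have := congrArg Subtype.val hμ
  simpa [R, LinearMap.restrict_apply] using this

end Restrict

end Summit.Ventures.HodgeRepro2.JointEigenbasis
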